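import Summits.AtomisticToContinuum.FouriersLaw.Theorems.BondHeatUncertaintyBoundedResponseParitySectorSplitB
import HarnessLib

/-!
# BondHeatUncertainty / BoundedResponse — «ParitySectorSplit» (lens-1 g101 NODE): part 3 of 3 (sequel of `…BondHeatUncertaintyBoundedResponseParitySectorSplitB`; the module docstring of part 1 `…ParitySectorSplitA` describes the node)

Split for the 400-line cap by the landing lane (hand-2 g37).  This part: §4 the doors — 11071 (door v7) and the 9121 stubs S4o / S4 from the odd grade alone.
Same namespace, section, opens and variables; all FQNs unchanged; bodies verbatim.  0 sorry; standard axioms.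
-/

noncomputable section

open MeasureTheory ProbabilityTheory Filter Topology Set Function
open scoped NNReal ENNReal
open Literature.MathematicalPhysics.KineticTheory.HeatConduction
open Literature.MathematicalPhysics.KineticTheory OscillatorChain
open Summit.AtomisticToContinuum.FouriersLaw.Theorems.SubdiffusiveBondHeat
open Summit.AtomisticToContinuum.FouriersLaw.Theorems.OddSectorIrreversibility
open Summit.AtomisticToContinuum.FouriersLaw.Theorems.BoundedResponse.TransientBand
open Summit.AtomisticToContinuum.FouriersLaw.Cruxes.SuperadditiveResistance.FloatingProbeBypassLaplacian
  (integral_flip_gibbsMeasure integrable_flip_gibbsMeasure measurePreserving_flip_gibbsMeasure)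

namespace Summit.AtomisticToContinuum.FouriersLaw.Theorems.BoundedResponse.ParityFloor

open Summit.AtomisticToContinuum.FouriersLaw.Theses.BondHeatUncertainty (BoundedResponse)
open Summit.AtomisticToContinuum.FouriersLaw.Theorems.BoundedResponse.TransientBand (TransientCeilingPoint)
open Summit.AtomisticToContinuum.FouriersLaw.Theorems.SubdiffusiveBondHeat.EscapeGrading (CurrentCorrectorBudget)

section ParitySectorSplit

variable {ω₂ lam β γ T : ℝ} {N : ℕ}

/-! ## §4 Doors: 11071 (door v7) and the 9121 stubs S4o / S4 from the odd grade alone -/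

/-- ★ **DOOR v7: 11071 ⟸ (D_F) ∧ (E₁ᶜ) ∧ (O₁ᶜ)** — door v6 `boundedResponse_of_leakPoint_correctorGrade_one` with its
`N`-uniform leg (C₁) ≡ CCB(3) split by parity. [folklore] -/
theorem boundedResponse_of_leakPoint_even_odd :
    LeakPoint → EvenCorrectorGrade 1 → OddCorrectorGrade 1 → BoundedResponse := fun hF hE hO =>
  boundedResponse_of_leakPoint_correctorGrade_one hF (correctorGrade_of_even_odd hE hO)

/-- ★ **DOOR v7, transient-band vocabulary: 11071 ⟸ (D_F) ∧ (U^u₁) ∧ (O₁ᶜ)**. [folklore] -/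
theorem boundedResponse_of_leakPoint_parity :
    LeakPoint → TransientCeilingUniform 1 → OddCorrectorGrade 1 → BoundedResponse := fun hF hU hO =>
  boundedResponse_of_leakPoint_correctorGrade_one hF (correctorGrade_of_parity hU hO)

/-- **(Oᶜ_s) ⟹ (O_s) `OddSnapshotGrade s`** — `oddDefect(μ_{N,T,T}) h = (γ²/T⁴)·oddDefect(μ_T) h₀` for every response density
`h` (tree `oddDefect_eq_of_isResponseDensity`). [formal bookkeeping] -/
theorem oddSnapshotGrade_of_oddCorrectorGrade {s : ℝ} : OddCorrectorGrade s → OddSnapshotGrade s := by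
  intro hO ω₂ lam β γ hω hl hβ hγ hU μ hμ T hT
  obtain ⟨C, N₀, hC⟩ := hO ω₂ lam β γ hω hl hβ hγ T hT
  refine ⟨γ ^ 2 / T ^ 4 * C, max N₀ 2, fun N h hN hh => ?_⟩
  have hN2 : 2 ≤ N := le_trans (le_max_right _ _) hN
  have hN₀ : N₀ ≤ N := le_trans (le_max_left _ _) hN
  have hN0 : 0 < N := by omega
  rw [oddDefect_eq_of_isResponseDensity hω hl hβ hγ hU hμ hT hN2 hh]
  have h1 : ∫ z, (kinCorrector ω₂ lam β γ T N ⟨0, by omega⟩ z - kinCorrector ω₂ lam β γ T N ⟨0, by omega⟩ (z.1, -z.2)) ^ 2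
      ∂((pinnedChain ω₂ lam β γ).gibbsMeasure N T) ≤ C * (N : ℝ) ^ s := hC N hN0 hN₀
  calc γ ^ 2 / T ^ 4 * ∫ z, (kinCorrector ω₂ lam β γ T N ⟨0, by omega⟩ z -
          kinCorrector ω₂ lam β γ T N ⟨0, by omega⟩ (z.1, -z.2)) ^ 2 ∂((pinnedChain ω₂ lam β γ).gibbsMeasure N T)
      ≤ γ ^ 2 / T ^ 4 * (C * (N : ℝ) ^ s) := mul_le_mul_of_nonneg_left h1 (by positivity)
    _ = _ := by ring

/-- **(O₁ᶜ) for every `N ≥ 1`** (the finitely many `N < N₀` absorbed into the constant; `oddDefect ≥ 0`). [formal bookkeeping] -/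
theorem oddCorrectorGrade_one_forall (hO : OddCorrectorGrade 1) :
    ∀ ω₂ lam β γ : ℝ, 0 < ω₂ → 0 < lam → 0 < β → 0 < γ → ∀ T : ℝ, 0 < T →
      ∃ C : ℝ, 0 ≤ C ∧ ∀ (N : ℕ) (hN : 0 < N),
        oddDefect ((pinnedChain ω₂ lam β γ).gibbsMeasure N T) (kinCorrector ω₂ lam β γ T N ⟨0, hN⟩) ≤ C * (N : ℝ) := by
  intro ω₂ lam β γ hω hl hβ hγ T hT
  obtain ⟨C, N₀, hCN⟩ := hO ω₂ lam β γ hω hl hβ hγ T hT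
  set F : ℕ → ℝ := fun n =>
    if h : 0 < n then oddDefect ((pinnedChain ω₂ lam β γ).gibbsMeasure n T) (kinCorrector ω₂ lam β γ T n ⟨0, h⟩)
    else 0 with hF
  have hF0 : ∀ n, 0 ≤ F n := fun n => by
    by_cases h : 0 < n
    · simp only [hF, dif_pos h]; exact oddDefect_nonneg _ _
    · simp only [hF, dif_neg h]; exact le_rfl
  set S : ℝ := ∑ n ∈ Finset.range N₀, F n with hS
  have hS0 : 0 ≤ S := Finset.sum_nonneg fun n _ => hF0 n
  refine ⟨max C 0 + S, by positivity, fun N hN => ?_⟩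
  have hN1 : (1 : ℝ) ≤ N := by exact_mod_cast hN
  have hFN : F N = oddDefect ((pinnedChain ω₂ lam β γ).gibbsMeasure N T) (kinCorrector ω₂ lam β γ T N ⟨0, hN⟩) := by
    simp only [hF, dif_pos hN]
  by_cases hle : N₀ ≤ N
  · have h := hCN N hN hle
    rw [Real.rpow_one] at h
    have h2 : C * (N : ℝ) ≤ max C 0 * (N : ℝ) := mul_le_mul_of_nonneg_right (le_max_left _ _) (by positivity)
    nlinarith
  · have hlt : N < N₀ := not_le.mp hle
    have hle' : F N ≤ S := Finset.single_le_sum (fun n _ => hF0 n) (Finset.mem_range.2 hlt)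
    rw [← hFN]
    calc F N ≤ S := hle'
      _ ≤ S * (N : ℝ) := le_mul_of_one_le_right hS0 hN1
      _ ≤ (max C 0 + S) * (N : ℝ) := by nlinarith [le_max_right C 0]

/-- ★ **The McLennan corrector's reversal defect IS the odd grade, exactly** (fixed `N ≥ 2`): with the `let`-dictionary of
`stub_oddCorrectorBound` (`g = (γ/2T²)(p_0² − p_{N−1}²)`, `Pg s = P_s g`, `w = ∫_{(0,∞)} Pg s ds`) passed by defining equations,
`∫ (w − w∘Θ)² dμ_T = (γ/T²)²·oddDefect(μ_T) h₀`.  Steps: `w = (γ/2T²)(h₀ − h_{N−1})` pointwise (as in node 99L's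
`oddCorrector_core`); `h_{N−1} = (H − ⟨H⟩)/γ − h₀` `μ_T`-a.e. (`kinCorrector_pair_ae_eq`), also along `Θ` (`Θ_*μ_T = μ_T`);
`H∘Θ = H`; so `w − w∘Θ = (γ/T²)(h₀ − h₀∘Θ)` a.e. [folklore] -/
theorem oddCorrector_exact (hω : 0 < ω₂) (hl : 0 < lam) (hβ : 0 < β) (hγ : 0 < γ) (hT : 0 < T) (hN : 2 ≤ N)
    (g : PhaseSpace N → ℝ)
    (hg : g = fun y => γ / (2 * T ^ 2) * (y.2 ⟨0, by omega⟩ ^ 2 - y.2 ⟨N - 1, by omega⟩ ^ 2))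
    (Pg : ℝ → PhaseSpace N → ℝ)
    (hPg : Pg = fun s z => ∫ y, g y ∂((pinnedChain ω₂ lam β γ).transitionKernel N T T s.toNNReal z))
    (w : PhaseSpace N → ℝ) (hw : w = fun z => ∫ s in Set.Ioi (0 : ℝ), Pg s z) :
    ∫ z, (w z - w (z.1, -z.2)) ^ 2 ∂((pinnedChain ω₂ lam β γ).gibbsMeasure N T) =
      (γ / T ^ 2) ^ 2 * oddDefect ((pinnedChain ω₂ lam β γ).gibbsMeasure N T) (kinCorrector ω₂ lam β γ T N ⟨0, by omega⟩) := by
  have hN0 : 0 < N := by omega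
  obtain ⟨hϑ0, -, hϑ1⟩ := weight_facts hT
  obtain ⟨K, c, hK, hc, hb⟩ := harrisBound_exists hω hl.le hβ hγ hN0 hT hϑ0 hϑ1
  have hpair := kinCorrector_pair_ae_eq hω hl.le hβ hγ hN hT
  set P := pinnedChain ω₂ lam β γ with hP
  set μT := P.gibbsMeasure N T with hμT
  set a : ℝ := γ / (2 * T ^ 2) with ha
  set h0 : PhaseSpace N → ℝ := kinCorrector ω₂ lam β γ T N ⟨0, by omega⟩ with hh0
  set h1 : PhaseSpace N → ℝ := kinCorrector ω₂ lam β γ T N ⟨N - 1, by omega⟩ with hh1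
  set Hc : PhaseSpace N → ℝ := fun z => P.hamiltonian N z - ∫ x, P.hamiltonian N x ∂μT with hHc
  -- §1 `w = a(h₀ − h₁)` pointwise (kernel integrability of `θ_b`, absolute convergence of the Kubo integrals)
  have hObs : ∀ (b : Fin N) (s : ℝ) (z : PhaseSpace N),
      Integrable (kinObs T N b) (P.transitionKernel N T T s.toNNReal z) := by
    intro b s z
    have hE := pinnedChain_integrable_exp_mul_hamiltonian_transitionKernel hω hl.le hT hβ.le hγ.le hN0 hϑ0 hϑ1
      s.toNNReal z
    refine (hE.const_mul (2 / (1 / (4 * T)) + T)).mono' (continuous_kinObs T b).aestronglyMeasurable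
      (Eventually.of_forall fun y => ?_)
    rw [Real.norm_eq_abs]
    exact abs_kinObs_le hω hl.le hβ.le hT.le hϑ0 b y
  have hPgpt : ∀ (s : ℝ) (z : PhaseSpace N),
      Pg s z = a * (kinAct ω₂ lam β γ T N ⟨0, by omega⟩ s z - kinAct ω₂ lam β γ T N ⟨N - 1, by omega⟩ s z) := by
    intro s z
    rw [hPg, hg]
    show ∫ y, γ / (2 * T ^ 2) * (y.2 ⟨0, by omega⟩ ^ 2 - y.2 ⟨N - 1, by omega⟩ ^ 2)
        ∂(P.transitionKernel N T T s.toNNReal z) = _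
    have hfun : (fun y : PhaseSpace N => γ / (2 * T ^ 2) * (y.2 ⟨0, by omega⟩ ^ 2 - y.2 ⟨N - 1, by omega⟩ ^ 2)) =
        fun y => γ / (2 * T ^ 2) * (kinObs T N ⟨0, by omega⟩ y - kinObs T N ⟨N - 1, by omega⟩ y) := by
      funext y; simp only [kinObs]; ring
    rw [hfun, integral_const_mul, integral_sub (hObs _ s z) (hObs _ s z)]
    rfl
  have hwpt : ∀ z : PhaseSpace N, w z = a * (h0 z - h1 z) := by
    intro z
    rw [hw]
    show ∫ s in Set.Ioi (0 : ℝ), Pg s z = _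
    simp only [hPgpt]
    rw [integral_const_mul, integral_sub (kinAct_integrableOn hω hl.le hβ hγ hT hϑ0 hb hc _ z).1
      (kinAct_integrableOn hω hl.le hβ hγ hT hϑ0 hb hc _ z).1]
    rfl
  -- §2 the coboundary along `Θ`, and `H∘Θ = H`
  have hpairΘ : ∀ᵐ z ∂μT, h0 (z.1, -z.2) + h1 (z.1, -z.2) = Hc (z.1, -z.2) / γ := by
    have h := (measurePreserving_flip_gibbsMeasure P N T).quasiMeasurePreserving.ae hpair
    simpa only [momentumReversal_apply] using h
  have hHcΘ : ∀ z : PhaseSpace N, Hc (z.1, -z.2) = Hc z := fun z => by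
    simp only [hHc, OscillatorChain.hamiltonian_neg_momentum]
  -- §3 `(w − w∘Θ)² = (2a)²(h₀ − h₀∘Θ)²` a.e., integrate
  have hae : ∀ᵐ z ∂μT, (w z - w (z.1, -z.2)) ^ 2 = (γ / T ^ 2) ^ 2 * (h0 z - h0 (z.1, -z.2)) ^ 2 := by
    filter_upwards [hpair, hpairΘ] with z hz hzΘ
    have e1 : h1 z = Hc z / γ - h0 z := by
      have hz' : h0 z + h1 z = Hc z / γ := hz
      linarith
    have e2 : h1 (z.1, -z.2) = Hc z / γ - h0 (z.1, -z.2) := by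
      have hz' : h0 (z.1, -z.2) + h1 (z.1, -z.2) = Hc (z.1, -z.2) / γ := hzΘ
      rw [hHcΘ z] at hz'
      linarith
    rw [hwpt z, hwpt (z.1, -z.2), e1, e2, ha]
    ring
  unfold oddDefect
  rw [integral_congr_ae hae, integral_const_mul]

/-- ★ **(O₁ᶜ) ⟹ S4o `stub_oddCorrectorBound`** of the line `clausius-budget-sound-window` of crux
`ExtensiveSnapshotIrreversibility` (9121) — conclusion VERBATIM the registered (derived) stub, constant `(γ/T²)²·C`
(`oddCorrector_exact`, `oddCorrectorGrade_one_forall`; the uniqueness guard is unused). [formal bookkeeping] -/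
theorem oddCorrectorBound_of_oddCorrectorGrade_one (hO : OddCorrectorGrade 1) :
    ∀ ω₂ lam β γ : ℝ, 0 < ω₂ → 0 < lam → 0 < β → 0 < γ →
      (∀ (N : ℕ) (T_L T_R : ℝ), 0 < T_L → 0 < T_R → ∀ μ ν : Measure (PhaseSpace N),
        (pinnedChain ω₂ lam β γ).IsSteadyState N T_L T_R μ →
        (pinnedChain ω₂ lam β γ).IsSteadyState N T_L T_R ν → μ = ν) →
      ∀ T : ℝ, 0 < T → ∃ C : ℝ, ∀ (N : ℕ) (hN : 2 ≤ N),
        let P := pinnedChain ω₂ lam β γ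
        let μT := P.gibbsMeasure N T
        let g : PhaseSpace N → ℝ := fun y =>
          γ / (2 * T ^ 2) * (y.2 ⟨0, by omega⟩ ^ 2 - y.2 ⟨N - 1, by omega⟩ ^ 2)
        let Pg : ℝ → PhaseSpace N → ℝ := fun s z => ∫ y, g y ∂(P.transitionKernel N T T s.toNNReal z)
        let w : PhaseSpace N → ℝ := fun z => ∫ s in Set.Ioi (0 : ℝ), Pg s z
        ∫ z, (w z - w (z.1, -z.2)) ^ 2 ∂μT ≤ C * N := by
  intro ω₂ lam β γ hω hl hβ hγ _huniq T hT
  obtain ⟨C, hC0, hC⟩ := oddCorrectorGrade_one_forall hO ω₂ lam β γ hω hl hβ hγ T hT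
  refine ⟨(γ / T ^ 2) ^ 2 * C, fun N hN => ?_⟩
  intro P μT g Pg w
  have hN0 : 0 < N := by omega
  rw [oddCorrector_exact hω hl hβ hγ hT hN g rfl Pg rfl w rfl, mul_assoc]
  exact mul_le_mul_of_nonneg_left (hC N hN0) (sq_nonneg _)

/-- **S4o ⟹ (O₁ᶜ)** — the converse: the stub's uniqueness guard is the tree's `uniqueNESS`, and `oddCorrector_exact`;
constant `(T²/γ)²·C`, `N₀ = 2`.  So (O₁ᶜ) IS the `N`-uniform content of the 9121 line. [formal bookkeeping] -/
theorem oddCorrectorGrade_one_of_oddCorrectorBound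
    (hS : ∀ ω₂ lam β γ : ℝ, 0 < ω₂ → 0 < lam → 0 < β → 0 < γ →
      (∀ (N : ℕ) (T_L T_R : ℝ), 0 < T_L → 0 < T_R → ∀ μ ν : Measure (PhaseSpace N),
        (pinnedChain ω₂ lam β γ).IsSteadyState N T_L T_R μ →
        (pinnedChain ω₂ lam β γ).IsSteadyState N T_L T_R ν → μ = ν) →
      ∀ T : ℝ, 0 < T → ∃ C : ℝ, ∀ (N : ℕ) (hN : 2 ≤ N),
        let P := pinnedChain ω₂ lam β γ
        let μT := P.gibbsMeasure N T
        let g : PhaseSpace N → ℝ := fun y =>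
          γ / (2 * T ^ 2) * (y.2 ⟨0, by omega⟩ ^ 2 - y.2 ⟨N - 1, by omega⟩ ^ 2)
        let Pg : ℝ → PhaseSpace N → ℝ := fun s z => ∫ y, g y ∂(P.transitionKernel N T T s.toNNReal z)
        let w : PhaseSpace N → ℝ := fun z => ∫ s in Set.Ioi (0 : ℝ), Pg s z
        ∫ z, (w z - w (z.1, -z.2)) ^ 2 ∂μT ≤ C * N) :
    OddCorrectorGrade 1 := by
  intro ω₂ lam β γ hω hl hβ hγ T hT
  obtain ⟨C, hC⟩ := hS ω₂ lam β γ hω hl hβ hγ (uniqueNESS hω hl hβ hγ) T hT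
  refine ⟨(T ^ 2 / γ) ^ 2 * C, 2, fun N hN0 hN2 => ?_⟩
  have h := hC N hN2
  have e := oddCorrector_exact hω hl hβ hγ hT hN2 _ rfl _ rfl _ rfl
  have h' : (γ / T ^ 2) ^ 2 * oddDefect ((pinnedChain ω₂ lam β γ).gibbsMeasure N T)
      (kinCorrector ω₂ lam β γ T N ⟨0, by omega⟩) ≤ C * N := by
    rw [← e]; exact h
  have hpos : 0 < (γ / T ^ 2) ^ 2 := by positivity
  have e3 : (T ^ 2 / γ) ^ 2 * (γ / T ^ 2) ^ 2 = 1 := by field_simp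
  rw [Real.rpow_one]
  calc oddDefect ((pinnedChain ω₂ lam β γ).gibbsMeasure N T) (kinCorrector ω₂ lam β γ T N ⟨0, hN0⟩)
      = (T ^ 2 / γ) ^ 2 * ((γ / T ^ 2) ^ 2 * oddDefect ((pinnedChain ω₂ lam β γ).gibbsMeasure N T)
          (kinCorrector ω₂ lam β γ T N ⟨0, by omega⟩)) := by rw [← mul_assoc, e3, one_mul]
    _ ≤ (T ^ 2 / γ) ^ 2 * (C * N) := mul_le_mul_of_nonneg_left h' (sq_nonneg _)
    _ = _ := by ring

/-- ★ **(O₁ᶜ) ⟹ S4 `stub_lateOddResponse`** (conclusion VERBATIM the registered stub), by the 9121 lead's landed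
`lateOddResponse_of_oddCorrectorBound` (`τ = 0`). So 9121 ⟸ S1r′ ∧ (O₁ᶜ). [formal bookkeeping] -/
theorem lateOddResponse_of_oddCorrectorGrade_one (hO : OddCorrectorGrade 1) :
    ∀ ω₂ lam β γ : ℝ, 0 < ω₂ → 0 < lam → 0 < β → 0 < γ →
      (∀ (N : ℕ) (T_L T_R : ℝ), 0 < T_L → 0 < T_R → ∀ μ ν : Measure (PhaseSpace N),
        (pinnedChain ω₂ lam β γ).IsSteadyState N T_L T_R μ →
        (pinnedChain ω₂ lam β γ).IsSteadyState N T_L T_R ν → μ = ν) →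
      ∀ T : ℝ, 0 < T → ∃ C c : ℝ, 0 < c ∧ ∀ (N : ℕ) (hN : 2 ≤ N),
        let P := pinnedChain ω₂ lam β γ
        let μT := P.gibbsMeasure N T
        (∀ t : ℝ≥0, μT.bind (P.transitionKernel N T T t) = μT) →
        (∀ ϑ : ℝ, 0 < ϑ → ϑ < 1 / T → ∃ C c : ℝ, 0 < C ∧ 0 < c ∧
          ∀ (z : PhaseSpace N) (t : ℝ≥0) (f : PhaseSpace N → ℝ), Continuous f →
            (∀ y, |f y| ≤ Real.exp (ϑ * P.hamiltonian N y)) →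
            |(∫ y, f y ∂(P.transitionKernel N T T t z)) - ∫ y, f y ∂μT| ≤
              C * Real.exp (ϑ * P.hamiltonian N z) * Real.exp (-c * t)) →
        let g : PhaseSpace N → ℝ := fun y =>
          γ / (2 * T ^ 2) * (y.2 ⟨0, by omega⟩ ^ 2 - y.2 ⟨N - 1, by omega⟩ ^ 2)
        let Pg : ℝ → PhaseSpace N → ℝ := fun s z => ∫ y, g y ∂(P.transitionKernel N T T s.toNNReal z)
        let w : PhaseSpace N → ℝ := fun z => ∫ s in Set.Ioi (0 : ℝ), Pg s z
        let Pw : ℝ → PhaseSpace N → ℝ := fun τ z => ∫ x, w x ∂(P.transitionKernel N T T τ.toNNReal z)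
        ∃ τ : ℝ, 0 ≤ τ ∧ τ ≤ c * N ∧ MemLp (Pw τ) 2 μT ∧
          ∫ z, (Pw τ z - Pw τ (z.1, -z.2)) ^ 2 ∂μT ≤ C * N :=
  fun ω₂ lam β γ hω hl hβ hγ hU T hT =>
    Summit.AtomisticToContinuum.FouriersLaw.Theorems.ExtensiveSnapshotIrreversibility.ClausiusBudget.lateOddResponse_of_oddCorrectorBound
      ω₂ lam β γ hω hl hβ hγ hU T hT (oddCorrectorBound_of_oddCorrectorGrade_one hO ω₂ lam β γ hω hl hβ hγ hU T hT)

end ParitySectorSplit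

end Summit.AtomisticToContinuum.FouriersLaw.Theorems.BoundedResponse.ParityFloor

end
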